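import Literature.NumberTheory.PAdicHodge.DeRhamDescent
import Literature.NumberTheory.PAdicHodge.DeRhamInduceLocal
import HarnessLib

/-!
# De Rham descent along a finite extension of the base — discharge of `DeRhamDescent`

The named fact `Literature.NumberTheory.PAdicHodge.DeRhamDescent` (`DeRhamDescent.lean`;
Brinon–Conrad 2009, Prop. 6.3.8, converse half, tree form for the pinned data `fontainePst`) is,
binder for binder, the theorem
`Literature.NumberTheory.PAdicHodge.isDeRhamFramed_of_isDeRhamFramed_comp_absGaloisRestrict` of
`DeRhamInduceLocal.lean` (the local induction theorem, Patrikis 2019 Lemma 7.2.1, and the Frobenius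
counit: `ρ` is a quotient of `Ind(ρ|_{Γ_L})`).  This file records the one-line discharge.

## References
* [BrinonConrad2009] O. Brinon, B. Conrad, *CMI Summer School notes on p-adic Hodge theory*
  (2009), Prop. 6.3.8.
* [Patrikis2019] S. Patrikis, *Variations on a theorem of Tate*, Mem. AMS 258 (2019), Lemma 7.2.1.
-/

namespace Literature.NumberTheory.PAdicHodge

/-- **De Rham descent (Brinon–Conrad 2009, Prop. 6.3.8, converse half) — the named fact
`DeRhamDescent` holds**, by `isDeRhamFramed_of_isDeRhamFramed_comp_absGaloisRestrict`.
[cite: BrinonConrad2009, Prop. 6.3.8] [cite: Patrikis2019, Lemma 7.2.1] -/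
theorem DeRhamDescent_holds : DeRhamDescent := by
  intro K L _ _ _ _ _ _ _ _ _ _ _ hcont ℓ _ hK hL n ρ h
  exact isDeRhamFramed_of_isDeRhamFramed_comp_absGaloisRestrict hcont hK hL ρ h

end Literature.NumberTheory.PAdicHodge
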